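import Literature.Computability.AlgebraicComplexity.BLMW11InvariantDimensionTransport
import Literature.Computability.AlgebraicComplexity.BLMW11DegreeDivisibilityProofs
import Literature.Computability.AlgebraicComplexity.BLMW11SymKroneckerProofs
import Literature.RepresentationTheory.GeneralLinear.PlethysmWordModel
import Literature.RepresentationTheory.GeneralLinear.WordModelIsotypicSpan
import Literature.RepresentationTheory.FiniteGroups.SymmetricGroupFrobeniusFormula
import Mathlib.LinearAlgebra.PID
import HarnessLib

/-!
# BLMW 2011, Cor. 8.4.2 / Prop. 5.5.2 (proof): the character of the per-slice space,
# `χ₀ = ∑_{μ ⊢_m mδ} p_μ χ^μ`, and the discharge of `BLMW2011_prop_5_5_2_invariants` / `_closure`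

Topic `Literature/Computability/AlgebraicComplexity` (val-lit cell, DAG rows BLMW11-A/B; discharge of
the named facts `BLMW2011_prop_5_5_2_invariants` and `BLMW2011_prop_5_5_2_closure` of
`BLMW11StabilityInheritance.lean`, in their degree-guarded reading `0 < δ` of ERRATUM A19 and with
the CORRECTED `mult_π` = `BLMW2011.multPer`). Source: P. Bürgisser, J. M. Landsberg, L. Manivel,
J. Weyman, *An overview of mathematical issues arising in the geometric complexity theory approach
to VP ≠ VNP*, SIAM J. Comput. 40 (2011) = arXiv:0907.2850, §5.5 (proof of Prop. 5.5.2; v1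
Prop. 5.3, arXiv p. 10) and §8.4 (Cor. 8.4.2; v1 Cor. 8.3, arXiv p. 19: "The dimension of the
space of `𝔖_n`-invariants in the zero weight space `(S_μℂ^n)_0` equals the multiplicity of `S_μℂ^n`
in the plethysm `S^n(S^δℂ^n)`").

## What is proved (no definitions, no named facts; `sorry`-free)

Write `χ₀` for the character of `𝔖_D` on the slice space `X₀ = perSliceSpace k m D` of
`BLMW11PerOrbitCeiling.lean` (functions of words `[D] → [m]` supported on the words of constant
content and invariant under relabelling the letters; for `D = mδ` this is BLMW's
`((E^{⊗mδ})_0)^{𝔚_E}`, `E = k^m`), and `p_μ = plethysmCoeffOfPartition k m δ μ` (the multiplicity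
of `S_μ(k^m)` in `S^m(S^δ(k^m))`, `SchurWeylPlethysm.lean`).

* `sum_spechtCharacter_mul_character_perSliceSpace` (§3, any field of characteristic zero):
  `∑_{τ ∈ 𝔖_{mδ}} χ^μ(τ) χ₀(τ) = (mδ)! · p_μ` for `μ ⊢ mδ` with `ℓ(μ) ≤ m`, `δ > 0` — the
  multiplicity of `[μ]` in `X₀` is `p_μ` (BLMW Cor. 8.4.2 in the form used by the proof of
  Prop. 5.5.2: `X₀ ≅ ⊕_μ X_μ ⊗ [μ]`, `dim X_μ = p_μ`).
* `sum_spechtCharacter_mul_character_perSliceSpace_eq_zero` (§4, `ℂ`): the sum is `0` when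
  `ℓ(μ) > m` (`X₀ ⊆ (ℂ^m)^{⊗D}` carries no `[μ]`, Schur–Weyl); `classInner_character_perSliceSpace_…`
  (the two statements as `⟨χ₀, χ^μ⟩ = p_μ`, resp. `= 0`); `character_perSliceSpace_eq_sum`:
  **`χ₀(τ) = ∑_{μ ∈ BLMW2011.partsLE m δ} p_μ χ^μ(τ)`** pointwise.
* `perOrbitCeiling_eq_multPer` (§5, `ℂ`): for `m ≥ 1`, `δ > 0`, `ℓ(π) ≤ m²`,
  `perOrbitCeiling ℂ m δ π = BLMW2011.multPer ℂ m δ π`, by inserting `χ₀ = ∑ p_μ χ^μ` into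
  `2·(mδ)!·perOrbitCeiling = ∑_τ χ^π(τ)(χ₀(τ)² + χ₀(τ²))` (`two_mul_factorial_mul_perOrbitCeiling`)
  and evaluating with `∑_τ χ^μχ^νχ^π = (mδ)! k_{μνπ}` (`kroneckerCoeff_eq_sum_spechtCharacter_holds`)
  and `∑_τ χ^π(χ^μ(τ)² + χ^μ(τ²)) = 2(mδ)! sk^π_{μμ}` (`two_mul_factorial_mul_symKroneckerCoeff`):
  `2·perOrbitCeiling = ∑_{μ,ν} k_{πμν} p_μp_ν + ∑_μ p_μ(2 sk^π_{μμ} - k_{πμμ}) = 2·mult_π`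
  (corrected `mult_π`, Λ²-summand included).
* `BLMW2011_prop_5_5_2_invariants_holds : BLMW2011_prop_5_5_2_invariants` and
  `BLMW2011_prop_5_5_2_closure_holds : BLMW2011_prop_5_5_2_closure` — through
  `BLMW2011_per_invariants_iff_perOrbitCeiling`, `BLMW2011_prop_5_5_2_invariants_right` and
  `BLMW2011_per_closure_of_invariants` (`BLMW11InvariantDimensionTransport.lean`,
  `BLMW11DegreeDivisibilityProofs.lean`).

## The proof of the multiplicity formula (§1–§3): an elementary count replacing Gay's theorem

BLMW obtain `dim X_μ = p_μ` from Gay's theorem (Thm. 8.4.1/Cor. 8.4.2). Here the same number is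
reached inside the tree's word model, where `p_μ = dim HW_μ((k^m)^{⊗mδ})^{𝔖_m ≀ 𝔖_δ}`
(`plethysmCoeffOfPartition_eq_finrank_wreathHW`, `PlethysmWordModel.lean`) and
`|𝔖_m ≀ 𝔖_δ| · dim HW_μ^{𝔖_m ≀ 𝔖_δ} = ∑_{κ ∈ 𝔖_m ≀ 𝔖_δ} χ^μ(κ)` (`card_mul_finrank_wreathHW`,
Schur–Weyl `character_hwPermRep`): (§2) `X₀` is the image of the averaging projector
`(Qy)(w) = [cont(w) constant]·(m!)⁻¹ ∑_{σ ∈ 𝔖_m} y(σ ∘ w)`, which commutes with `𝔖_D`, so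
`χ₀(τ) = tr(τ ∘ Q)` on all functions of words (`LinearMap.trace_restrict_eq_of_forall_mem`) and
`m! χ₀(τ) = #{(w, σ) : cont(w) constant, σ ∘ w ∘ τ = w}`; (§1) for the block word
`w₀ = blockIdx m δ` (position ↦ its block) the relabellings repairing `w₀ ∘ τ` number `1` if `τ` lies
in the wreath product `blockPerms m δ` (namely `σ = (blockMap τ)⁻¹`) and `0` otherwise, and
`|blockPerms m δ| = m! · |Stab(w₀)|`; (§3) every word of content `(δ^m)` is `w₀ ∘ g`, along which the
count is conjugated (`spechtCharacter_conj`, orbit–stabilizer `sum_comp_perm_eq_card_stab_smul` of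
`SymmetricGroupFrobeniusOrthogonality.lean`), giving
`m! ∑_τ χ^μ(τ)χ₀(τ) = #{w} · ∑_{κ ∈ 𝔖_m ≀ 𝔖_δ} χ^μ(κ) = #{w} · |𝔖_m ≀ 𝔖_δ| · p_μ = (mδ)! · m! · p_μ`.
The vanishing for `ℓ(μ) > m` (§4) is the tree's `isotypicProj_wordPermRep_eq_zero_of_lt`
(`WordModelIsotypicSpan.lean`) restricted to `X₀` and read through `trace_isotypicProj`; the
pointwise expansion is Serre's Fourier expansion of a class function
(`IsClassFun.eq_sum_classInner_smul`, `irrChars_toFinset_perm_eq`).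

HONEST FRAMING. Classical representation theory (Schur–Weyl duality, characters of `𝔖_D`,
Gay 1976 / BLMW 2011 §5.5, §8.4) closing the per-side bookkeeping of BLMW's Prop. 5.5.2 in the
tree's rendering; nothing here bears on permanent versus determinant lower bounds; VP ≠ VNP is
not proved and nothing in this file is progress on it. No new definitions, no new named facts.

## References

* [BurgisserEtAl2011] §5.5, Def. 5.5.1, Prop. 5.5.2 (proof: `(S_π(E⊗F))^{T,N} = ⊕ (X_μ ⊗ X_ν) ⊗ K`,
  `X_μ = (S_μE)_0^{𝔚_E}`, `p_μ = dim X_μ`), §8.4 Thm. 8.4.1 (Gay), Cor. 8.4.2 (arXiv v1: Prop. 5.3,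
  Thm. 8.2, Cor. 8.3; pp. 10, 19).
* [FultonHarrisGTM129] W. Fulton, J. Harris, *Representation Theory*, GTM 129: (2.9)–(2.10)
  (multiplicities by characters), Thm. 6.3 (Schur–Weyl), Lemma 6.22.
* [SerreLinearRepresentations1977] J.-P. Serre, *Linear Representations of Finite Groups*, §2.5
  Thm. 6, §2.6 Thm. 8 (isotypic projectors, Fourier expansion of class functions).

## Tree

`perSliceSpace`, `perSliceSpace_le_comap`, `perOrbitCeiling`, `two_mul_factorial_mul_perOrbitCeiling`
(`BLMW11PerOrbitCeiling`); `BLMW2011.partsLE`, `BLMW2011.multPer`, `multPerTwice`, `multPerOmitted`,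
`multPer_eq`, `symKroneckerCoeff`, `BLMW2011_prop_5_5_2_invariants`, `BLMW2011_prop_5_5_2_closure`
(`BLMW11StabilityInheritance`); `BLMW2011_per_invariants_iff_perOrbitCeiling`,
`BLMW2011_per_closure_of_invariants` (`BLMW11InvariantDimensionTransport`);
`BLMW2011_prop_5_5_2_invariants_right` (`BLMW11DegreeDivisibilityProofs`);
`two_mul_factorial_mul_symKroneckerCoeff`, `BLMW2011_symKroneckerCoeff_le_holds`
(`BLMW11SymKroneckerProofs`); `kroneckerCoeff_eq_sum_spechtCharacter_holds`, `spechtCharacter_conj`;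
`blockIdx`, `blockPerms`, `mem_blockPerms` (`PlethysmStability`); `blockMap`, `blockMapFun`,
`blockIdx_apply_of_mem`, `card_mul_finrank_wreathHW` (`WreathHighestWeight`);
`plethysmCoeffOfPartition_eq_finrank_wreathHW` (`PlethysmWordModel`); `Word`, `wordContent`,
`sum_wordContent`, `wordContent_comp_perm`, `wordPerm_apply`, `wordPermRep_apply`;
`sum_comp_perm_eq_card_stab_smul` (`SymmetricGroupFrobeniusOrthogonality`);
`spechtCharacter_one_ne_zero'` (`SymmetricGroupFrobeniusFormula`); `isotypicProj_wordPermRep_eq_zero_of_lt`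
(`WordModelIsotypicSpan`); `isotypicProj_apply`, `trace_isotypicProj`, `classInner_apply`,
`IsCharacter.isClassFun`, `IsClassFun.eq_sum_classInner_smul`, `irrChars_toFinset_perm_eq`,
`spechtCharacter_injective`, `spechtCharacter_inv` (`IsotypicProjector`, `IrreducibleCharacters`,
`InducedClassFunction`, `SymmetricGroupIsotypic`); Mathlib `LinearMap.trace_restrict_eq_of_forall_mem`,
`LinearMap.trace_eq_matrix_trace`, `Representation.subrepresentation`.
-/

noncomputable section

open scoped BigOperators
open Finset Module

namespace Literature.Computability.AlgebraicComplexity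

open _root_.Literature.NumberTheory.DiophantineGeometry
open _root_.Literature.RepresentationTheory.GeneralLinear
open _root_.Literature.RepresentationTheory.FiniteGroups

/-! ### §1 Counting on the block word `w₀ = blockIdx m δ` -/

section BlockWord

variable {m δ : ℕ}

/-- Relabelling the letters permutes the content: `cont(σ ∘ u)_i = cont(u)_{σ⁻¹ i}`. [folklore] -/
private theorem wordContent_perm_comp {N n : ℕ} (σ : Equiv.Perm (Fin N)) (u : Word N n)
    (i : Fin N) : wordContent (⇑σ ∘ u) i = wordContent u (σ.symm i) := by
  unfold wordContent
  congr 1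
  ext p
  simp only [mem_filter, mem_univ, true_and, Function.comp_apply, Equiv.apply_eq_iff_eq_symm_apply]

/-- Every block has `δ` positions: the block word `w₀ : q ↦ block(q)` has content `(δ, …, δ)`.
[folklore] -/
private theorem card_filter_blockIdx (a : Fin m) :
    (univ.filter fun p : Fin (m * δ) => blockIdx m δ p = a).card = δ := by
  have h : (univ.filter fun p : Fin (m * δ) => blockIdx m δ p = a) =
      (univ : Finset (Fin δ)).map ⟨fun p => finProdFinEquiv (a, p), fun p p' h => by
        simpa using h⟩ := by
    ext q
    simp only [mem_filter, mem_univ, true_and, mem_map, Function.Embedding.coeFn_mk]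
    constructor
    · intro hq
      exact ⟨(finProdFinEquiv.symm q).2, by rw [← hq]; exact finProdFinEquiv_blockIdx q⟩
    · rintro ⟨p, rfl⟩
      exact blockIdx_finProdFinEquiv a p
  rw [h, card_map, card_univ, Fintype.card_fin]

/-- For `τ` in the wreath product `𝔖_m ≀ 𝔖_δ` exactly one relabelling of the letters repairs the
block word: `σ ∘ w₀ ∘ τ = w₀` iff `σ = (blockMap τ)⁻¹`. [folklore] -/
private theorem card_filter_comp_blockIdx_of_mem [NeZero δ] {τ : Equiv.Perm (Fin (m * δ))}
    (hτ : τ ∈ blockPerms m δ) :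
    (univ.filter fun σ : Equiv.Perm (Fin m) => ⇑σ ∘ blockIdx m δ ∘ ⇑τ = blockIdx m δ).card = 1 := by
  rw [Finset.card_eq_one]
  refine ⟨(blockMap ⟨τ, hτ⟩)⁻¹, ?_⟩
  ext σ
  simp only [mem_filter, mem_univ, true_and, mem_singleton]
  constructor
  · intro h
    apply eq_inv_of_mul_eq_one_left
    ext r
    have hr := congr_fun h (finProdFinEquiv (r, (0 : Fin δ)))
    simp only [Function.comp_apply] at hr
    rw [blockIdx_apply_of_mem hτ, blockIdx_finProdFinEquiv] at hr
    rw [Equiv.Perm.coe_mul, Function.comp_apply, blockMap_apply, Equiv.Perm.coe_one, id_eq]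
    exact congrArg Fin.val hr
  · rintro rfl
    funext q
    obtain ⟨⟨r, p⟩, rfl⟩ := finProdFinEquiv.surjective q
    simp only [Function.comp_apply]
    rw [blockIdx_apply_of_mem hτ, blockIdx_finProdFinEquiv]
    change (blockMap ⟨τ, hτ⟩)⁻¹ (blockMap ⟨τ, hτ⟩ r) = r
    exact (blockMap ⟨τ, hτ⟩).symm_apply_apply r

/-- For `τ` outside the wreath product no relabelling repairs the block word. [folklore] -/
private theorem card_filter_comp_blockIdx_of_not_mem {τ : Equiv.Perm (Fin (m * δ))}
    (hτ : τ ∉ blockPerms m δ) :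
    (univ.filter fun σ : Equiv.Perm (Fin m) => ⇑σ ∘ blockIdx m δ ∘ ⇑τ = blockIdx m δ).card = 0 := by
  rw [Finset.card_eq_zero, Finset.filter_eq_empty_iff]
  intro σ _ h
  refine hτ (mem_blockPerms.mpr fun q q' => ?_)
  have hq := congr_fun h q
  have hq' := congr_fun h q'
  simp only [Function.comp_apply] at hq hq'
  rw [← hq, ← hq', σ.injective.eq_iff]

/-- Weighting by `#{σ | σ ∘ w₀ ∘ τ = w₀}` and summing over all `τ ∈ 𝔖_{mδ}` is summing over the
wreath product `𝔖_m ≀ 𝔖_δ`. [folklore] -/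
private theorem sum_card_filter_comp_blockIdx_smul [NeZero δ] {M : Type*} [AddCommMonoid M]
    (f : Equiv.Perm (Fin (m * δ)) → M) :
    ∑ τ : Equiv.Perm (Fin (m * δ)),
        (univ.filter fun σ : Equiv.Perm (Fin m) => ⇑σ ∘ blockIdx m δ ∘ ⇑τ = blockIdx m δ).card •
          f τ = ∑ τ : ↥(blockPerms m δ), f (τ : Equiv.Perm (Fin (m * δ))) := by
  classical
  rw [← Finset.sum_subtype (univ.filter (· ∈ blockPerms m δ)) (by simp) f, Finset.sum_filter]
  refine Finset.sum_congr rfl fun τ _ => ?_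
  by_cases hτ : τ ∈ blockPerms m δ
  · rw [if_pos hτ, card_filter_comp_blockIdx_of_mem hτ, one_smul]
  · rw [if_neg hτ, card_filter_comp_blockIdx_of_not_mem hτ, zero_smul]

/-- **`|𝔖_m ≀ 𝔖_δ| = m! · |Stab(w₀)|`**: the wreath product is the set-stabilizer of the
partition into blocks, an extension of `𝔖_m` (the induced permutation of the blocks, `blockMap`)
by the pointwise block stabilizer `Stab(w₀) = 𝔖_δ^m`; counted here through the relabellings
`σ ∘ w₀`, `σ ∈ 𝔖_m`, all of content `(δ^m)`. [folklore] -/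
private theorem card_blockPerms_eq [NeZero δ] :
    Nat.card ↥(blockPerms m δ) =
      (univ.filter fun g : Equiv.Perm (Fin (m * δ)) => blockIdx m δ ∘ ⇑g = blockIdx m δ).card *
        m.factorial := by
  have key := sum_comp_perm_eq_card_stab_smul (blockIdx m δ : Fin (m * δ) → Fin m)
    (fun w => (univ.filter fun σ : Equiv.Perm (Fin m) => ⇑σ ∘ blockIdx m δ = w).card)
  have hL : ∑ g : Equiv.Perm (Fin (m * δ)),
      (univ.filter fun σ : Equiv.Perm (Fin m) => ⇑σ ∘ blockIdx m δ = blockIdx m δ ∘ ⇑g).card =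
      Nat.card ↥(blockPerms m δ) := by
    have h1 : ∑ g : Equiv.Perm (Fin (m * δ)),
        (univ.filter fun σ : Equiv.Perm (Fin m) => ⇑σ ∘ blockIdx m δ = blockIdx m δ ∘ ⇑g).card =
        ∑ g : Equiv.Perm (Fin (m * δ)), (univ.filter fun σ : Equiv.Perm (Fin m) =>
          ⇑σ ∘ blockIdx m δ ∘ ⇑g = blockIdx m δ).card • (1 : ℕ) := by
      refine Fintype.sum_equiv (Equiv.inv _) _ _ fun g => ?_
      rw [smul_eq_mul, mul_one, Equiv.inv_apply]
      congr 1
      ext σ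
      simp only [mem_filter, mem_univ, true_and]
      constructor
      · intro h
        funext q
        have hq := congr_fun h (g⁻¹ q)
        simp only [Function.comp_apply, Equiv.Perm.coe_inv, Equiv.apply_symm_apply] at hq
        simp only [Function.comp_apply, Equiv.Perm.coe_inv]
        exact hq
      · intro h
        funext q
        have hq := congr_fun h (g q)
        simp only [Function.comp_apply, Equiv.Perm.coe_inv, Equiv.symm_apply_apply] at hq
        simp only [Function.comp_apply]
        exact hq
    rw [h1, sum_card_filter_comp_blockIdx_smul (fun _ => (1 : ℕ)), Finset.sum_const, smul_eq_mul,
      mul_one, Finset.card_univ, Nat.card_eq_fintype_card]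
  have hR : ∑ u ∈ univ.filter (fun u : Fin (m * δ) → Fin m =>
      ∀ a, (univ.filter fun p => u p = a).card = (univ.filter fun p => blockIdx m δ p = a).card),
      (univ.filter fun σ : Equiv.Perm (Fin m) => ⇑σ ∘ blockIdx m δ = u).card = m.factorial := by
    rw [Finset.sum_card_fiberwise_eq_card_filter, Finset.filter_true_of_mem, card_univ,
      Fintype.card_perm, Fintype.card_fin]
    intro σ _
    simp only [mem_filter, mem_univ, true_and, Function.comp_apply]
    intro a
    have : (univ.filter fun p : Fin (m * δ) => σ (blockIdx m δ p) = a) =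
        univ.filter fun p => blockIdx m δ p = σ.symm a := by
      ext p
      simp only [mem_filter, mem_univ, true_and]
      rw [Equiv.apply_eq_iff_eq_symm_apply]
    rw [this, card_filter_blockIdx, card_filter_blockIdx]
  rw [hL, smul_eq_mul] at key
  rw [key]
  congr 1
  convert hR using 10

end BlockWord

/-! ### §2 The character of `𝔖_D` on the slice space `X₀` as a count -/

section Trace

variable (k : Type*) [Field k] [CharZero k] (m D : ℕ)

/-- **`m! · χ₀(τ) = #{(w, σ) : cont(w) constant, σ ∘ w ∘ τ = w}`**, `χ₀` the character of `𝔖_D`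
on `X₀ = perSliceSpace k m D`: `X₀` is the image of the averaging projector
`(Qy)(w) = [cont(w) constant] · (m!)⁻¹ ∑_σ y(σ ∘ w)`, which commutes with the action of `𝔖_D`, so
`χ₀(τ) = tr(τ ∘ Q)` on all functions of words, read off in the basis of words.
[cite: BurgisserEtAl2011, Prop. 5.5.2 (proof)] -/
private theorem factorial_mul_character_perSliceSpace (τ : Equiv.Perm (Fin D)) :
    (m.factorial : k) *
        ((wordPermRep k m D).subrepresentation (perSliceSpace k m D)
          (perSliceSpace_le_comap k)).character τ =
      ∑ w ∈ univ.filter (fun w : Word m D => ∀ i j : Fin m, wordContent w i = wordContent w j),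
        ((univ.filter fun σ : Equiv.Perm (Fin m) => ⇑σ ∘ w ∘ ⇑τ = w).card : k) := by
  have hm0 : (m.factorial : k) ≠ 0 := Nat.cast_ne_zero.mpr (Nat.factorial_ne_zero m)
  -- the averaging projector onto `X₀`
  let Q : (Word m D → k) →ₗ[k] (Word m D → k) :=
    { toFun := fun y w => if (∀ i j : Fin m, wordContent w i = wordContent w j) then
          (m.factorial : k)⁻¹ * ∑ σ : Equiv.Perm (Fin m), y (⇑σ ∘ w) else 0
      map_add' := fun y y' => by
        funext w
        simp only [Pi.add_apply]
        split_ifs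
        · rw [Finset.sum_add_distrib, mul_add]
        · rw [add_zero]
      map_smul' := fun c y => by
        funext w
        simp only [Pi.smul_apply, smul_eq_mul, RingHom.id_apply]
        split_ifs
        · rw [Finset.mul_sum, Finset.mul_sum, Finset.mul_sum]
          exact Finset.sum_congr rfl fun σ _ => by ring
        · rw [mul_zero] }
  have hQ_apply : ∀ y w, Q y w = if (∀ i j : Fin m, wordContent w i = wordContent w j) then
      (m.factorial : k)⁻¹ * ∑ σ : Equiv.Perm (Fin m), y (⇑σ ∘ w) else 0 := fun _ _ => rfl
  -- `Q` lands in `X₀`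
  have hQ_mem : ∀ y, Q y ∈ perSliceSpace k m D := by
    intro y
    refine ⟨fun u hu => ?_, fun σ u => ?_⟩
    · obtain ⟨i, j, hij⟩ := hu
      rw [hQ_apply, if_neg (fun h => hij (h i j))]
    · rw [hQ_apply, hQ_apply]
      have hc : (∀ i j : Fin m, wordContent (⇑σ ∘ u) i = wordContent (⇑σ ∘ u) j) ↔
          ∀ i j : Fin m, wordContent u i = wordContent u j := by
        simp only [wordContent_perm_comp]
        exact ⟨fun h i j => by simpa using h (σ i) (σ j), fun h i j => h _ _⟩
      by_cases hu : ∀ i j : Fin m, wordContent u i = wordContent u j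
      · rw [if_pos (hc.mpr hu), if_pos hu]
        congr 1
        exact Fintype.sum_equiv (Equiv.mulRight σ) _ _ fun σ' => rfl
      · rw [if_neg (fun h => hu (hc.mp h)), if_neg hu]
  -- `Q` is the identity on `X₀`
  have hQ_id : ∀ y ∈ perSliceSpace k m D, Q y = y := by
    intro y hy
    funext w
    rw [hQ_apply]
    split_ifs with hw
    · rw [Finset.sum_congr rfl fun σ _ => hy.2 σ w, Finset.sum_const, Finset.card_univ,
        Fintype.card_perm, Fintype.card_fin, nsmul_eq_mul, ← mul_assoc, inv_mul_cancel₀ hm0,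
        one_mul]
    · obtain ⟨i, hi⟩ := not_forall.mp hw
      obtain ⟨j, hij⟩ := not_forall.mp hi
      exact (hy.1 w ⟨i, j, hij⟩).symm
  -- transfer the trace to all functions of words
  have hf : ∀ x, (wordPermRep k m D τ ∘ₗ Q) x ∈ perSliceSpace k m D :=
    fun x => perSliceSpace_le_comap k τ (hQ_mem x)
  have hres : (wordPermRep k m D).subrepresentation (perSliceSpace k m D)
      (perSliceSpace_le_comap k) τ = (wordPermRep k m D τ ∘ₗ Q).restrict (fun x _ => hf x) := by
    apply LinearMap.ext
    rintro ⟨y, hy⟩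
    apply Subtype.ext
    simp only [Representation.subrepresentation_apply, LinearMap.coe_restrict_apply,
      LinearMap.coe_comp, Function.comp_apply, hQ_id y hy]
  have htr : ((wordPermRep k m D).subrepresentation (perSliceSpace k m D)
      (perSliceSpace_le_comap k)).character τ =
      LinearMap.trace k (Word m D → k) (wordPermRep k m D τ ∘ₗ Q) := by
    change LinearMap.trace k _ _ = _
    rw [hres]
    exact LinearMap.trace_restrict_eq_of_forall_mem _ _ hf
  rw [htr, LinearMap.trace_eq_matrix_trace k (Pi.basisFun k (Word m D)), Matrix.trace,
    Finset.mul_sum, Finset.sum_filter]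
  refine Finset.sum_congr rfl fun w _ => ?_
  rw [Matrix.diag_apply, LinearMap.toMatrix_apply, Pi.basisFun_apply, Pi.basisFun_repr,
    LinearMap.coe_comp, Function.comp_apply, wordPermRep_apply, wordPerm_apply, hQ_apply]
  have hcw : (∀ i j : Fin m, wordContent (w ∘ ⇑τ) i = wordContent (w ∘ ⇑τ) j) ↔
      ∀ i j : Fin m, wordContent w i = wordContent w j := by
    simp only [wordContent_comp_perm]
  by_cases hw : ∀ i j : Fin m, wordContent w i = wordContent w j
  · rw [if_pos (hcw.mpr hw), if_pos hw, ← mul_assoc, mul_inv_cancel₀ hm0, one_mul]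
    simp only [Pi.single_apply]
    rw [Finset.sum_boole]
  · rw [if_neg (fun h => hw (hcw.mp h)), if_neg hw, mul_zero]

end Trace

/-! ### §3 `∑_τ χ^μ(τ) χ₀(τ) = (mδ)! · p_μ` for `μ ⊢_m mδ` -/

section PlethysmSum

variable (k : Type*) [Field k] [CharZero k] {m δ : ℕ}

/-- **The multiplicity of `[μ]` in the slice space `X₀` is the plethysm coefficient `p_μ`**
(BLMW 2011, proof of Prop. 5.5.2 with Cor. 8.4.2: `X₀ = ((E^{⊗mδ})_0)^{𝔚_E} ≅ ⊕_μ X_μ ⊗ [μ]`,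
`dim X_μ = p_μ = mult(S_μE, S^m(S^δE))`), in character form over any field of characteristic zero:
`∑_{τ ∈ 𝔖_{mδ}} χ^μ(τ) χ₀(τ) = (mδ)! · p_μ` for every `μ ⊢ mδ` with at most `m` parts and `δ > 0`
(`p_μ = plethysmCoeffOfPartition k m δ μ`). Proof (elementary, replacing Gay's theorem by a
count): `m! χ₀(τ) = #{(w, σ) : cont(w) = (δ^m), σ ∘ w ∘ τ = w}`
(`factorial_mul_character_perSliceSpace`); every such `w` is `w₀ ∘ g` for the block word `w₀`,
along which the count is conjugated into the wreath product `𝔖_m ≀ 𝔖_δ = {τ : ∃σ, σ ∘ w₀ ∘ τ = w₀}`;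
so `m! ∑_τ χ^μ χ₀ = |{w}| · ∑_{κ ∈ 𝔖_m ≀ 𝔖_δ} χ^μ(κ) = |{w}| · |𝔖_m ≀ 𝔖_δ| · p_μ`
(`card_mul_finrank_wreathHW`, `plethysmCoeffOfPartition_eq_finrank_wreathHW`: `p_μ = dim HW_μ^{𝔖_m ≀ 𝔖_δ}`),
and `|{w}| · |𝔖_m ≀ 𝔖_δ| = (mδ)! · m!`. [cite: BurgisserEtAl2011, Prop. 5.5.2 (proof) and Cor. 8.4.2] -/
theorem sum_spechtCharacter_mul_character_perSliceSpace [NeZero m] (hδ : 0 < δ)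
    (μ : Nat.Partition (m * δ)) (hμ : μ.parts.card ≤ m) :
    ∑ τ : Equiv.Perm (Fin (m * δ)), spechtCharacter k μ τ *
        ((wordPermRep k m (m * δ)).subrepresentation (perSliceSpace k m (m * δ))
          (perSliceSpace_le_comap k)).character τ =
      ((m * δ).factorial : k) * (plethysmCoeffOfPartition k m δ μ : k) := by
  haveI : NeZero δ := ⟨hδ.ne'⟩
  have hm0 : (m.factorial : k) ≠ 0 := Nat.cast_ne_zero.mpr (Nat.factorial_ne_zero m)
  -- the orbit sum `F(w) = ∑_τ #{σ | σ ∘ w ∘ τ = w} χ^μ(τ)`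
  set F : Word m (m * δ) → k := fun w => ∑ τ : Equiv.Perm (Fin (m * δ)),
    ((univ.filter fun σ : Equiv.Perm (Fin m) => ⇑σ ∘ w ∘ ⇑τ = w).card : k) * spechtCharacter k μ τ
    with hF
  -- (1) `m! ∑_τ χ^μ χ₀ = ∑_{w : cont constant} F w`
  have h1 : (m.factorial : k) * ∑ τ : Equiv.Perm (Fin (m * δ)), spechtCharacter k μ τ *
      ((wordPermRep k m (m * δ)).subrepresentation (perSliceSpace k m (m * δ))
        (perSliceSpace_le_comap k)).character τ =
      ∑ w ∈ univ.filter (fun w : Word m (m * δ) => ∀ i j : Fin m, wordContent w i = wordContent w j),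
        F w := by
    rw [Finset.mul_sum]
    have key : ∀ τ : Equiv.Perm (Fin (m * δ)), (m.factorial : k) * (spechtCharacter k μ τ *
        ((wordPermRep k m (m * δ)).subrepresentation (perSliceSpace k m (m * δ))
          (perSliceSpace_le_comap k)).character τ) =
        ∑ w ∈ univ.filter (fun w : Word m (m * δ) => ∀ i j : Fin m, wordContent w i = wordContent w j),
          ((univ.filter fun σ : Equiv.Perm (Fin m) => ⇑σ ∘ w ∘ ⇑τ = w).card : k) *
            spechtCharacter k μ τ := by
      intro τ
      rw [mul_left_comm, factorial_mul_character_perSliceSpace k m (m * δ) τ, Finset.mul_sum]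
      exact Finset.sum_congr rfl fun w _ => mul_comm _ _
    rw [Finset.sum_congr rfl fun τ _ => key τ, Finset.sum_comm]
  -- (2) for `D = mδ`, constant content means content `(δ^m)` = the content of the block word
  have hCT : (univ.filter fun w : Word m (m * δ) => ∀ i j : Fin m, wordContent w i = wordContent w j) =
      univ.filter fun u : Fin (m * δ) → Fin m =>
        ∀ a, (univ.filter fun p => u p = a).card = (univ.filter fun p => blockIdx m δ p = a).card := by
    ext w
    simp only [mem_filter, mem_univ, true_and, card_filter_blockIdx]
    constructor
    · intro h a
      have hs := sum_wordContent w
      rw [Finset.sum_congr rfl fun i _ => h i a, Finset.sum_const, Finset.card_univ,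
        Fintype.card_fin, smul_eq_mul] at hs
      exact Nat.eq_of_mul_eq_mul_left (NeZero.pos m) hs
    · intro h i j
      exact (h i).trans (h j).symm
  -- (3) `F` is constant along the orbit of the block word (conjugation into the wreath product)
  have hconj : ∀ g : Equiv.Perm (Fin (m * δ)), F (blockIdx m δ ∘ ⇑g) = F (blockIdx m δ) := by
    intro g
    simp only [hF]
    refine Fintype.sum_equiv (MulAut.conj g).toEquiv _ _ fun τ => ?_
    simp only [MulEquiv.toEquiv_eq_coe, MulEquiv.coe_toEquiv, MulAut.conj_apply]
    rw [spechtCharacter_conj]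
    congr 3
    ext σ
    simp only [mem_filter, mem_univ, true_and]
    constructor
    · intro h
      funext q
      have hq := congr_fun h (g⁻¹ q)
      simp only [Function.comp_apply, Equiv.Perm.coe_inv, Equiv.apply_symm_apply] at hq
      simp only [Function.comp_apply, Equiv.Perm.coe_mul, Equiv.Perm.coe_inv]
      exact hq
    · intro h
      funext q
      have hq := congr_fun h (g q)
      simp only [Function.comp_apply, Equiv.Perm.coe_mul, Equiv.Perm.coe_inv,
        Equiv.symm_apply_apply] at hq
      simp only [Function.comp_apply]
      exact hq
  -- (4) `F(w₀) = ∑_{κ ∈ 𝔖_m ≀ 𝔖_δ} χ^μ(κ) = |𝔖_m ≀ 𝔖_δ| · p_μ`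
  have hF0 : F (blockIdx m δ) =
      (Nat.card ↥(blockPerms m δ) : k) * (plethysmCoeffOfPartition k m δ μ : k) := by
    simp only [hF]
    have h := sum_card_filter_comp_blockIdx_smul (m := m) (δ := δ) (M := k) (spechtCharacter k μ)
    simp only [nsmul_eq_mul] at h
    rw [h, plethysmCoeffOfPartition_eq_finrank_wreathHW k m hδ.ne' μ hμ,
      card_mul_finrank_wreathHW k m 1 μ hμ]
    refine Finset.sum_congr rfl fun τ _ => ?_
    rw [MonoidHom.one_apply, Units.val_one, Int.cast_one, one_mul]
  -- (5) orbit–stabilizer: `(mδ)! · F(w₀) = |Stab(w₀)| · ∑_{cont(w) = (δ^m)} F(w)`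
  have key : ∑ g : Equiv.Perm (Fin (m * δ)), F (blockIdx m δ ∘ ⇑g) =
      (univ.filter fun g : Equiv.Perm (Fin (m * δ)) => blockIdx m δ ∘ ⇑g = blockIdx m δ).card •
        ∑ w ∈ univ.filter (fun w : Word m (m * δ) =>
          ∀ i j : Fin m, wordContent w i = wordContent w j), F w := by
    rw [hCT]
    convert sum_comp_perm_eq_card_stab_smul (blockIdx m δ : Fin (m * δ) → Fin m) F using 10
  rw [Finset.sum_congr rfl fun g _ => hconj g, Finset.sum_const, Finset.card_univ,
    Fintype.card_perm, Fintype.card_fin, hF0, card_blockPerms_eq, ← h1, nsmul_eq_mul,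
    nsmul_eq_mul, Nat.cast_mul] at key
  have hs : ((univ.filter fun g : Equiv.Perm (Fin (m * δ)) =>
      blockIdx m δ ∘ ⇑g = blockIdx m δ).card : k) ≠ 0 :=
    Nat.cast_ne_zero.mpr (Finset.card_pos.mpr ⟨1, by simp⟩).ne'
  refine mul_left_cancel₀ hm0 (mul_left_cancel₀ hs ?_)
  rw [← key]
  ring

end PlethysmSum

/-! ### §4 Over `ℂ`: `⟨χ₀, χ^μ⟩ = p_μ` for `ℓ(μ) ≤ m`, `= 0` for `ℓ(μ) > m`, and `χ₀ = ∑_μ p_μ χ^μ` -/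

section Complex

variable {m δ : ℕ}

/-- **No `[μ]` with more than `m` rows occurs in `X₀`**: `∑_{τ ∈ 𝔖_D} χ^μ(τ) χ₀(τ) = 0` whenever
`ℓ(μ) > m` — `X₀ ⊆ (ℂ^m)^{⊗D}`, on which the isotypic projector of `[μ]` vanishes
(`isotypicProj_wordPermRep_eq_zero_of_lt`, Schur–Weyl: `S_μ(ℂ^m) = 0`), so its trace
`χ^μ(1) ⟨χ^μ, χ₀⟩` on `X₀` is zero. [cite: FultonHarrisGTM129, Thm. 6.3 (1)] -/
theorem sum_spechtCharacter_mul_character_perSliceSpace_eq_zero {D : ℕ} (μ : Nat.Partition D)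
    (hμ : m < μ.parts.card) :
    ∑ τ : Equiv.Perm (Fin D), spechtCharacter ℂ μ τ *
        ((wordPermRep ℂ m D).subrepresentation (perSliceSpace ℂ m D)
          (perSliceSpace_le_comap ℂ)).character τ = 0 := by
  set ρ₀ := (wordPermRep ℂ m D).subrepresentation (perSliceSpace ℂ m D)
    (perSliceSpace_le_comap ℂ) with hρ₀
  -- the isotypic projector of `[μ]` vanishes on all functions of words, hence on `X₀`
  have hP : isotypicProj ρ₀ (spechtCharacter ℂ μ) = 0 := by
    apply LinearMap.ext
    intro v
    apply Subtype.ext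
    have h0 := LinearMap.congr_fun (isotypicProj_wordPermRep_eq_zero_of_lt (n := D) hμ)
      (v : Word m D → ℂ)
    rw [isotypicProj_apply, LinearMap.zero_apply] at h0
    rw [LinearMap.zero_apply, isotypicProj_apply, Submodule.coe_zero, ← h0, Submodule.coe_sum]
    refine Finset.sum_congr rfl fun t _ => ?_
    rw [Submodule.coe_smul, hρ₀, Representation.subrepresentation_apply,
      LinearMap.coe_restrict_apply]
  have htr := trace_isotypicProj ρ₀ (spechtCharacter ℂ μ)
  rw [hP, map_zero] at htr
  have hci : classInner (spechtCharacter ℂ μ) ρ₀.character = 0 :=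
    (mul_eq_zero.mp htr.symm).resolve_left (spechtCharacter_one_ne_zero' μ)
  rw [classInner_apply] at hci
  have hsum := (mul_eq_zero.mp hci).resolve_left
    (inv_ne_zero (Nat.cast_ne_zero.mpr Fintype.card_ne_zero))
  rw [← hsum]
  refine Fintype.sum_equiv (Equiv.inv _) _ _ fun s => ?_
  rw [Equiv.inv_apply, inv_inv,
    _root_.Literature.RepresentationTheory.FiniteGroups.spechtCharacter_inv]

/-- **`⟨χ₀, χ^μ⟩ = p_μ`** (BLMW 2011, Cor. 8.4.2 in multiplicity form): the multiplicity of the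
Specht module `[μ]` in `X₀ = ((E^{⊗mδ})_0)^{𝔚_E}` is the plethysm coefficient
`p_μ = mult(S_μE, S^m(S^δE)) = plethysmCoeffOfPartition ℂ m δ μ`, for `μ ⊢ mδ` with at most `m`
parts and `δ > 0`. [cite: BurgisserEtAl2011, Cor. 8.4.2] -/
theorem classInner_character_perSliceSpace_spechtCharacter [NeZero m] (hδ : 0 < δ)
    (μ : Nat.Partition (m * δ)) (hμ : μ.parts.card ≤ m) :
    classInner ((wordPermRep ℂ m (m * δ)).subrepresentation (perSliceSpace ℂ m (m * δ))
        (perSliceSpace_le_comap ℂ)).character (spechtCharacter ℂ μ) =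
      plethysmCoeffOfPartition ℂ m δ μ := by
  rw [classInner_apply, Fintype.card_perm, Fintype.card_fin,
    Finset.sum_congr rfl fun s _ => by
      rw [_root_.Literature.RepresentationTheory.FiniteGroups.spechtCharacter_inv, mul_comm],
    sum_spechtCharacter_mul_character_perSliceSpace ℂ hδ μ hμ, ← mul_assoc,
    inv_mul_cancel₀ (Nat.cast_ne_zero.mpr (Nat.factorial_ne_zero _)), one_mul]

/-- `⟨χ₀, χ^μ⟩ = 0` for `μ ⊢ D` with more than `m` parts. [cite: FultonHarrisGTM129, Thm. 6.3 (1)] -/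
theorem classInner_character_perSliceSpace_spechtCharacter_eq_zero {D : ℕ} (μ : Nat.Partition D)
    (hμ : m < μ.parts.card) :
    classInner ((wordPermRep ℂ m D).subrepresentation (perSliceSpace ℂ m D)
        (perSliceSpace_le_comap ℂ)).character (spechtCharacter ℂ μ) = 0 := by
  rw [classInner_apply, Finset.sum_congr rfl fun s _ => by
      rw [_root_.Literature.RepresentationTheory.FiniteGroups.spechtCharacter_inv, mul_comm],
    sum_spechtCharacter_mul_character_perSliceSpace_eq_zero μ hμ, mul_zero]

/-- **BLMW 2011, Cor. 8.4.2 (character form): `χ₀ = ∑_{μ ⊢_m mδ} p_μ χ^μ`** — the character of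
`𝔖_{mδ}` on `X₀ = ((E^{⊗mδ})_0)^{𝔚_E} ≅ ⊕_{μ ⊢_m mδ} X_μ ⊗ [μ]`, `dim X_μ = p_μ`
(`plethysmCoeffOfPartition ℂ m δ μ`), for `δ > 0`; the sum over `BLMW2011.partsLE m δ`
(partitions with at most `m` parts). Fourier expansion of the class function `χ₀`
(`IsClassFun.eq_sum_classInner_smul`) with the two preceding multiplicity computations.
[cite: BurgisserEtAl2011, Cor. 8.4.2 and Prop. 5.5.2 (proof)] -/
theorem character_perSliceSpace_eq_sum [NeZero m] (hδ : 0 < δ) (τ : Equiv.Perm (Fin (m * δ))) :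
    ((wordPermRep ℂ m (m * δ)).subrepresentation (perSliceSpace ℂ m (m * δ))
        (perSliceSpace_le_comap ℂ)).character τ =
      ∑ μ ∈ BLMW2011.partsLE m δ,
        (plethysmCoeffOfPartition ℂ m δ μ : ℂ) * spechtCharacter ℂ μ τ := by
  classical
  set ρ₀ := (wordPermRep ℂ m (m * δ)).subrepresentation (perSliceSpace ℂ m (m * δ))
    (perSliceSpace_le_comap ℂ) with hρ₀
  have hcl : IsClassFun ρ₀.character :=
    IsCharacter.isClassFun ⟨_, _, _, inferInstance, ρ₀, rfl⟩
  have hexp := hcl.eq_sum_classInner_smul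
  rw [irrChars_toFinset_perm_eq, Finset.sum_image fun μ _ ν _ h => spechtCharacter_injective h]
    at hexp
  rw [hexp, Finset.sum_apply, BLMW2011.partsLE, Finset.sum_filter]
  refine Finset.sum_congr rfl fun μ _ => ?_
  rw [Pi.smul_apply, smul_eq_mul]
  split_ifs with hμ
  · rw [hρ₀, classInner_character_perSliceSpace_spechtCharacter hδ μ hμ]
  · rw [hρ₀, classInner_character_perSliceSpace_spechtCharacter_eq_zero μ (not_le.mp hμ), zero_mul]

end Complex

/-! ### §5 `perOrbitCeiling = mult_π` (BLMW (5.5.2) via (4.1.2)) and the discharges -/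

section PerCeiling

variable {m δ : ℕ}

/-- **The per-side ceiling equals BLMW's corrected `mult_π`**: for `m ≥ 1`, `δ > 0` and `π ⊢ mδ`
with `ℓ(π) ≤ m²`, `perOrbitCeiling ℂ m δ π = BLMW2011.multPer ℂ m δ π`
`= ½ ∑_{μ ≠ ν} k_{πμν} p_μ p_ν + ∑_μ [sk^π_{μμ} C(p_μ+1, 2) + (k_{πμμ} - sk^π_{μμ}) C(p_μ, 2)]`.
Proof as in BLMW Prop. 5.5.2 in character form: `2 · (mδ)! · perOrbitCeiling = ∑_τ χ^π(τ)
(χ₀(τ)² + χ₀(τ²))` (`two_mul_factorial_mul_perOrbitCeiling`), `χ₀ = ∑_μ p_μ χ^μ`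
(`character_perSliceSpace_eq_sum`, Cor. 8.4.2), `∑_τ χ^μ χ^ν χ^π = (mδ)! k_{μνπ}`
(`kroneckerCoeff_eq_sum_spechtCharacter_holds`) and `∑_τ χ^π(τ)(χ^μ(τ)² + χ^μ(τ²)) = 2(mδ)! sk^π_{μμ}`
(`two_mul_factorial_mul_symKroneckerCoeff`), whence
`2 · perOrbitCeiling = ∑_{μ,ν} k_{πμν} p_μ p_ν + ∑_μ p_μ (2 sk^π_{μμ} - k_{πμμ}) = 2 · mult_π`.
[cite: BurgisserEtAl2011, Prop. 5.5.2 (proof) and Cor. 8.4.2] -/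
theorem perOrbitCeiling_eq_multPer [NeZero m] (hδ : 0 < δ) (π : Nat.Partition (m * δ))
    (hπ : π.parts.card ≤ m * m) :
    perOrbitCeiling ℂ m δ π = BLMW2011.multPer ℂ m δ π := by
  classical
  -- (1) character side
  have hC3 : ∀ μ ν : Nat.Partition (m * δ), ∑ τ : Equiv.Perm (Fin (m * δ)),
      spechtCharacter ℂ μ τ * spechtCharacter ℂ ν τ * spechtCharacter ℂ π τ =
        ((m * δ).factorial : ℂ) * (kroneckerCoeff ℂ μ ν π : ℂ) := by
    intro μ ν
    rw [← Nat.cast_mul]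
    exact (kroneckerCoeff_eq_sum_spechtCharacter_holds ℂ μ ν π).symm
  have hC4 : ∀ μ : Nat.Partition (m * δ), ∑ τ : Equiv.Perm (Fin (m * δ)),
      spechtCharacter ℂ π τ * spechtCharacter ℂ μ (τ * τ) =
        2 * ((m * δ).factorial : ℂ) * (symKroneckerCoeff ℂ π μ : ℂ) -
          ((m * δ).factorial : ℂ) * (kroneckerCoeff ℂ μ μ π : ℂ) := by
    intro μ
    have h := two_mul_factorial_mul_symKroneckerCoeff ℂ π μ
    rw [Finset.sum_congr rfl fun τ _ => mul_add _ _ _, Finset.sum_add_distrib] at h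
    have hsq : ∑ τ : Equiv.Perm (Fin (m * δ)),
        spechtCharacter ℂ π τ * spechtCharacter ℂ μ τ ^ 2 =
        ((m * δ).factorial : ℂ) * (kroneckerCoeff ℂ μ μ π : ℂ) := by
      rw [← hC3 μ μ]
      exact Finset.sum_congr rfl fun τ _ => by ring
    rw [hsq] at h
    push_cast at h
    linear_combination (-1 : ℂ) * h
  have hchar := two_mul_factorial_mul_perOrbitCeiling (k := ℂ) (m := m) π hπ
  rw [Finset.sum_congr rfl fun τ _ => by
    rw [character_perSliceSpace_eq_sum hδ τ, character_perSliceSpace_eq_sum hδ (τ * τ)]] at hchar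
  have hexp : ∑ τ : Equiv.Perm (Fin (m * δ)), spechtCharacter ℂ π τ *
      ((∑ μ ∈ BLMW2011.partsLE m δ, (plethysmCoeffOfPartition ℂ m δ μ : ℂ) * spechtCharacter ℂ μ τ) ^ 2 +
        ∑ μ ∈ BLMW2011.partsLE m δ,
          (plethysmCoeffOfPartition ℂ m δ μ : ℂ) * spechtCharacter ℂ μ (τ * τ)) =
      ∑ μ ∈ BLMW2011.partsLE m δ, ∑ ν ∈ BLMW2011.partsLE m δ,
        (plethysmCoeffOfPartition ℂ m δ μ : ℂ) * (plethysmCoeffOfPartition ℂ m δ ν : ℂ) *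
          ∑ τ : Equiv.Perm (Fin (m * δ)),
            spechtCharacter ℂ μ τ * spechtCharacter ℂ ν τ * spechtCharacter ℂ π τ +
      ∑ μ ∈ BLMW2011.partsLE m δ, (plethysmCoeffOfPartition ℂ m δ μ : ℂ) *
        ∑ τ : Equiv.Perm (Fin (m * δ)), spechtCharacter ℂ π τ * spechtCharacter ℂ μ (τ * τ) := by
    have hτ : ∀ τ : Equiv.Perm (Fin (m * δ)), spechtCharacter ℂ π τ *
        ((∑ μ ∈ BLMW2011.partsLE m δ,
            (plethysmCoeffOfPartition ℂ m δ μ : ℂ) * spechtCharacter ℂ μ τ) ^ 2 +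
          ∑ μ ∈ BLMW2011.partsLE m δ,
            (plethysmCoeffOfPartition ℂ m δ μ : ℂ) * spechtCharacter ℂ μ (τ * τ)) =
        ∑ μ ∈ BLMW2011.partsLE m δ, ∑ ν ∈ BLMW2011.partsLE m δ,
          (plethysmCoeffOfPartition ℂ m δ μ : ℂ) * (plethysmCoeffOfPartition ℂ m δ ν : ℂ) *
            (spechtCharacter ℂ μ τ * spechtCharacter ℂ ν τ * spechtCharacter ℂ π τ) +
        ∑ μ ∈ BLMW2011.partsLE m δ, (plethysmCoeffOfPartition ℂ m δ μ : ℂ) *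
          (spechtCharacter ℂ π τ * spechtCharacter ℂ μ (τ * τ)) := by
      intro τ
      have e1 : spechtCharacter ℂ π τ *
          (∑ μ ∈ BLMW2011.partsLE m δ,
            (plethysmCoeffOfPartition ℂ m δ μ : ℂ) * spechtCharacter ℂ μ τ) ^ 2 =
          ∑ μ ∈ BLMW2011.partsLE m δ, ∑ ν ∈ BLMW2011.partsLE m δ,
            (plethysmCoeffOfPartition ℂ m δ μ : ℂ) * (plethysmCoeffOfPartition ℂ m δ ν : ℂ) *
              (spechtCharacter ℂ μ τ * spechtCharacter ℂ ν τ * spechtCharacter ℂ π τ) := by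
        rw [sq, Finset.sum_mul_sum, Finset.mul_sum]
        refine Finset.sum_congr rfl fun μ _ => ?_
        rw [Finset.mul_sum]
        exact Finset.sum_congr rfl fun ν _ => by ring
      have e2 : spechtCharacter ℂ π τ * ∑ μ ∈ BLMW2011.partsLE m δ,
            (plethysmCoeffOfPartition ℂ m δ μ : ℂ) * spechtCharacter ℂ μ (τ * τ) =
          ∑ μ ∈ BLMW2011.partsLE m δ, (plethysmCoeffOfPartition ℂ m δ μ : ℂ) *
            (spechtCharacter ℂ π τ * spechtCharacter ℂ μ (τ * τ)) := by
        rw [Finset.mul_sum]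
        exact Finset.sum_congr rfl fun μ _ => by ring
      rw [mul_add, e1, e2]
    have f1 : ∑ τ : Equiv.Perm (Fin (m * δ)), ∑ μ ∈ BLMW2011.partsLE m δ, ∑ ν ∈ BLMW2011.partsLE m δ,
          (plethysmCoeffOfPartition ℂ m δ μ : ℂ) * (plethysmCoeffOfPartition ℂ m δ ν : ℂ) *
            (spechtCharacter ℂ μ τ * spechtCharacter ℂ ν τ * spechtCharacter ℂ π τ) =
        ∑ μ ∈ BLMW2011.partsLE m δ, ∑ ν ∈ BLMW2011.partsLE m δ,
          (plethysmCoeffOfPartition ℂ m δ μ : ℂ) * (plethysmCoeffOfPartition ℂ m δ ν : ℂ) *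
            ∑ τ : Equiv.Perm (Fin (m * δ)),
              spechtCharacter ℂ μ τ * spechtCharacter ℂ ν τ * spechtCharacter ℂ π τ := by
      rw [Finset.sum_comm]
      refine Finset.sum_congr rfl fun μ _ => ?_
      rw [Finset.sum_comm]
      refine Finset.sum_congr rfl fun ν _ => ?_
      rw [Finset.mul_sum]
    have f2 : ∑ τ : Equiv.Perm (Fin (m * δ)), ∑ μ ∈ BLMW2011.partsLE m δ,
          (plethysmCoeffOfPartition ℂ m δ μ : ℂ) *
            (spechtCharacter ℂ π τ * spechtCharacter ℂ μ (τ * τ)) =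
        ∑ μ ∈ BLMW2011.partsLE m δ, (plethysmCoeffOfPartition ℂ m δ μ : ℂ) *
          ∑ τ : Equiv.Perm (Fin (m * δ)), spechtCharacter ℂ π τ * spechtCharacter ℂ μ (τ * τ) := by
      rw [Finset.sum_comm]
      exact Finset.sum_congr rfl fun μ _ => by rw [Finset.mul_sum]
    rw [Finset.sum_congr rfl fun τ _ => hτ τ, Finset.sum_add_distrib, f1, f2]
  rw [hexp] at hchar
  simp only [hC3, hC4] at hchar
  -- (2) numeric side: `2 · mult_π = ∑_{μ,ν} k_{πμν} p_μ p_ν + ∑_μ p_μ (2 sk^π_{μμ} - k_{πμμ})`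
  have hnum : ((BLMW2011.multPerTwice ℂ m δ π + 2 * BLMW2011.multPerOmitted ℂ m δ π : ℕ) : ℂ) =
      ∑ μ ∈ BLMW2011.partsLE m δ, ∑ ν ∈ BLMW2011.partsLE m δ,
        (plethysmCoeffOfPartition ℂ m δ μ : ℂ) * (plethysmCoeffOfPartition ℂ m δ ν : ℂ) *
          (kroneckerCoeff ℂ μ ν π : ℂ) +
      ∑ μ ∈ BLMW2011.partsLE m δ, (plethysmCoeffOfPartition ℂ m δ μ : ℂ) *
        (2 * (symKroneckerCoeff ℂ π μ : ℂ) - (kroneckerCoeff ℂ μ μ π : ℂ)) := by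
    have hsub : ∀ μ : Nat.Partition (m * δ),
        ((kroneckerCoeff ℂ μ μ π - symKroneckerCoeff ℂ π μ : ℕ) : ℂ) =
          (kroneckerCoeff ℂ μ μ π : ℂ) - (symKroneckerCoeff ℂ π μ : ℂ) := fun μ =>
      Nat.cast_sub (BLMW2011_symKroneckerCoeff_le_holds π μ)
    have hite : ∀ μ ∈ BLMW2011.partsLE m δ, (∑ ν ∈ BLMW2011.partsLE m δ,
        if μ ≠ ν then (kroneckerCoeff ℂ μ ν π : ℂ) * (plethysmCoeffOfPartition ℂ m δ μ : ℂ) *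
          (plethysmCoeffOfPartition ℂ m δ ν : ℂ) else 0) =
        ∑ ν ∈ BLMW2011.partsLE m δ, (plethysmCoeffOfPartition ℂ m δ μ : ℂ) *
          (plethysmCoeffOfPartition ℂ m δ ν : ℂ) * (kroneckerCoeff ℂ μ ν π : ℂ) -
          (plethysmCoeffOfPartition ℂ m δ μ : ℂ) * (plethysmCoeffOfPartition ℂ m δ μ : ℂ) *
            (kroneckerCoeff ℂ μ μ π : ℂ) := by
      intro μ hμ
      have key : ∀ ν : Nat.Partition (m * δ),
          (if μ ≠ ν then (kroneckerCoeff ℂ μ ν π : ℂ) * (plethysmCoeffOfPartition ℂ m δ μ : ℂ) *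
            (plethysmCoeffOfPartition ℂ m δ ν : ℂ) else 0) =
          (plethysmCoeffOfPartition ℂ m δ μ : ℂ) * (plethysmCoeffOfPartition ℂ m δ ν : ℂ) *
              (kroneckerCoeff ℂ μ ν π : ℂ) -
            if μ = ν then (plethysmCoeffOfPartition ℂ m δ μ : ℂ) *
              (plethysmCoeffOfPartition ℂ m δ ν : ℂ) * (kroneckerCoeff ℂ μ ν π : ℂ) else 0 := by
        intro ν
        by_cases h : μ = ν
        · rw [if_neg (not_not.mpr h), if_pos h, sub_self]
        · rw [if_pos h, if_neg h, sub_zero]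
          ring
      rw [Finset.sum_congr rfl fun ν _ => key ν, Finset.sum_sub_distrib, Finset.sum_ite_eq,
        if_pos hμ]
    simp only [BLMW2011.multPerTwice, BLMW2011.multPerOmitted]
    push_cast [hsub, Nat.cast_choose_two]
    rw [Finset.sum_congr rfl hite, Finset.mul_sum, Finset.mul_sum, ← Finset.sum_add_distrib,
      ← Finset.sum_add_distrib, ← Finset.sum_add_distrib]
    exact Finset.sum_congr rfl fun μ _ => by ring
  -- (3) comparison: `2 · (mδ)! · perOrbitCeiling = (mδ)! · (2 · mult_π)` in `ℕ`
  have hfin : ((2 * (m * δ).factorial * perOrbitCeiling ℂ m δ π : ℕ) : ℂ) =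
      (((m * δ).factorial *
        (BLMW2011.multPerTwice ℂ m δ π + 2 * BLMW2011.multPerOmitted ℂ m δ π) : ℕ) : ℂ) := by
    rw [hchar, Nat.cast_mul, hnum, mul_add, Finset.mul_sum, Finset.mul_sum]
    refine congrArg₂ (· + ·) (Finset.sum_congr rfl fun μ _ => ?_)
      (Finset.sum_congr rfl fun μ _ => by ring)
    rw [Finset.mul_sum]
    exact Finset.sum_congr rfl fun ν _ => by ring
  have hnat : 2 * (m * δ).factorial * perOrbitCeiling ℂ m δ π =
      (m * δ).factorial *
        (BLMW2011.multPerTwice ℂ m δ π + 2 * BLMW2011.multPerOmitted ℂ m δ π) := by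
    exact_mod_cast hfin
  have h2 : 2 * perOrbitCeiling ℂ m δ π =
      BLMW2011.multPerTwice ℂ m δ π + 2 * BLMW2011.multPerOmitted ℂ m δ π := by
    apply Nat.eq_of_mul_eq_mul_left (Nat.factorial_pos (m * δ))
    rw [← hnat]
    ring
  rw [BLMW2011.multPer_eq]
  omega

/-- **Discharge of `BLMW2011_prop_5_5_2_invariants` (BLMW 2011, Prop. 5.5.2, (5.5.2) via (4.1.2)),
in its degree-guarded reading (`0 < δ`, ERRATUM A19) and with the CORRECTED `mult_π`
(`BLMW2011.multPer`, ERRATUM of `BLMW11StabilityInheritance.lean`):** for `m ≥ 3`, `δ > 0` and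
`π ⊢ mδ` with `ℓ(π) ≤ m²`, `dim (S_πW)^{GL(W)(per_m)} = mult_π`
(`perOrbitCeiling_eq_finrank_subgroupInvariants` — Marcus–May and the transport to the literal
rendering, `BLMW2011_per_invariants_iff_perOrbitCeiling` — with `perOrbitCeiling_eq_multPer`);
and `(S_πW)^{GL(W)(per_m)} = 0` when `m ∤ |π|` (`BLMW2011_prop_5_5_2_invariants_right`).
[cite: BurgisserEtAl2011, Prop. 5.5.2 (5.5.2)] -/
theorem BLMW2011_prop_5_5_2_invariants_holds : BLMW2011_prop_5_5_2_invariants :=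
  ⟨BLMW2011_per_invariants_iff_perOrbitCeiling.mpr fun _ _ _ π _ hδ hπ =>
      perOrbitCeiling_eq_multPer hδ π hπ,
    BLMW2011_prop_5_5_2_invariants_right⟩

/-- **Discharge of `BLMW2011_prop_5_5_2_closure` (BLMW 2011, Prop. 5.5.2, (5.5.3))**, degree-guarded
reading (`0 < δ`, ERRATUM A19), corrected `mult_π`: for `m ≥ 3`, `δ > 0`, `π ⊢ mδ` with
`ℓ(π) ≤ m²`, the multiplicity of `π^*` in `ℂ[Δ_m(per_m)]` is at most `mult_π` ("immediate as
`ℂ[\overline{GL(W)·per_m}]_δ ⊆ ℂ[GL(W)·per_m]_δ`": `BLMW2011_per_closure_of_invariants` with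
`BLMW2011_prop_5_5_2_invariants_holds`). [cite: BurgisserEtAl2011, Prop. 5.5.2 (5.5.3)] -/
theorem BLMW2011_prop_5_5_2_closure_holds : BLMW2011_prop_5_5_2_closure :=
  fun m δ _ π hm hδ hπ =>
    BLMW2011_per_closure_of_invariants BLMW2011_prop_5_5_2_invariants_holds.1 m δ π hm hδ hπ

end PerCeiling

end Literature.Computability.AlgebraicComplexity

end
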